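import Summits.Ventures.PercRepro.Night2NonFatLineCell
import Summits.Ventures.PercRepro.Night2NonFatTen

/-!
# night-2: h21's cell `(2, 1)` for `V` a line plus at most five points, all sizes (gen 37)

The three sub-cases by the number of fat closures — at least two (`localShadowHall_two_one_five_fatClosures_free`, gen 28),
exactly one (`localShadowHall_fat`, gen 36), none (`localShadowHall_nonfat_of_line`, this gen) — assemble to
**`localShadowHall_two_one_of_line`**: every rank-`6` flat `G` of the cell `(2, 1)` whose `V = G ∖ K` contains a line with at most
five points off it satisfies the local Hall inequality, whatever the size of `G`.
Paper: proofs/NIGHT-2-g37.md §5.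
-/

namespace PercRepro.Shadow

open PercRepro.ThmH PercRepro.PerFlat

variable {α : Type*} [DecidableEq α] {M : Matroid α} [M.Finite] {G : Finset α}

/-- **h21's cell `(2, 1)` for `V` a line plus at most five points.** -/
theorem localShadowHall_two_one_of_line (hG : G ∈ flatsQ M (5 + 1)) (hd : (gr M \ G).card = 2)
    (hk : kColoops M G = 1) (hs : ∀ e ∈ gr M, ∀ f ∈ gr M, e ≠ f → rkN M {e, f} = 2)
    (hl : ∀ e ∈ gr M, M.Indep {e}) {ℓ : Finset α} (hℓ : ℓ ⊆ G \ coloops M G) (hrℓ : rkN M ℓ ≤ 2)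
    (h5 : ((G \ coloops M G) \ ℓ).card ≤ 5) : LocalShadowHall M 5 G := by
  rcases Nat.lt_or_ge (fatClosures M 5 G 2).card 2 with hlt | hge
  · rcases Nat.lt_or_ge (fatClosures M 5 G 2).card 1 with h0 | h1
    · have hnf : fatClosures M 5 G 2 = ∅ := Finset.card_eq_zero.1 (by omega)
      exact localShadowHall_nonfat_of_line hG hd hk hs hl hnf hℓ hrℓ h5
    · obtain ⟨B₀, hB₀, hm₀⟩ := exists_fat_member_of_card_eq_one hG hd (by omega)
      exact localShadowHall_fat hG hd hk hs hl (by omega) hB₀ hm₀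
  · exact localShadowHall_two_one_five_fatClosures_free hG hd hk hs hl hge

end PercRepro.Shadow
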